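import Mathlib.GroupTheory.FreeGroup.Basic
import Mathlib.LinearAlgebra.AffineSpace.AffineEquiv
import Mathlib.Data.Fin.VecNotation
import Literature.AlgebraicGeometry.HodgeTheory.LocallyTrivialExtensionClasses
import Summits.HodgeConjecture.HodgeConjecture.Theorems.LinearSystemTorelliLocalTubeSpanConj
import Summits.HodgeConjecture.HodgeConjecture.Theorems.LinearSystemTorelliLocalTubeSpanFrame
import Summits.HodgeConjecture.HodgeConjecture.Theorems.LinearSystemTorelliLocalTubeSpanSchnellExample

/-!
# Route LinearSystemTorelli — crux `LocalTubeSpan`: the thin configuration — the undetected class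

Helper file (`--supports stmt-HodgeConjecture-2490`, line `Sketch`, stub `stub_thinCocycle`).
A NEGATIVE boundary result for the crux.  The crux's mechanism is *cyclic detection*: the
injectivity of Schnell's third map `evalCoinv A : H¹(G, A) → ∏_{g ∈ G} A/(g - 1)A`,
`[φ] ↦ (φ g mod (g - 1)A)_g` (`Literature.AlgebraicGeometry.HodgeTheory.LocallyTrivialExtensionClasses`),
which C. Schnell, *Primitive cohomology and the tube mapping*, Math. Z. 268 (2010)
(= arXiv:0711.3927), §7 Prop. 12 proves for the monodromy group of a skew-symmetric VANISHING
LATTICE acting through its Picard–Lefschetz transvections (and loc. cit. §7 also prints an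
Example of a module for which the restriction map is not injective).  The present file shows
that the Picard–Lefschetz SHAPE of the generators alone does not imply cyclic detection: one
needs the lattice (Janssen's complete vanishing lattice, a detecting frame), not merely "a group
generated by integral symplectic transvections".

**The thin configuration.** `G = F₃ = ⟨x₀, x₁, x₂⟩` (free) acts on `ℚ²` through the three
integral symplectic transvections `T_i(v) = v - B₀(v, δ_i) δ_i` of the form
`B₀(x, y) = 4 (x₀ y₁ - x₁ y₀)` along `δ₀ = (1, 0)`, `δ₁ = (0, 1)`, `δ₂ = (1, 1) = δ₀ + δ₁`:

  `T₀(v) = (v₀ + 4 v₁, v₁)`, `T₁(v) = (v₀, v₁ - 4 v₀)`, `T₂(v) = v - 4 (v₀ - v₁) (1, 1)`.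

Granted the dichotomy `hclass` for the elements of `ρ(F₃)` (every `g` either has `ρ(g) - 1`
invertible or is conjugate to a power of a generator — the ping-pong / thin-group input, a
separate stub of the line), the cocycle `φ` with `φ(x₀) = φ(x₁) = 0`, `φ(x₂) = (1, 1)` is

* a cocycle (any generator values extend to a cocycle on a FREE group:
  `localTubeSpan_freeGroup_exists_cocycles₁`, via a homomorphism `F₃ → Aff(ℚ²)` lifting `ρ`);
* undetected by every single element: if `ρ(g) - 1` is invertible then `(g - 1)ℚ² = ℚ²`; if
  `g = h x_i^n h⁻¹` then undetectedness is conjugation invariant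
  (`localTubeSpan_cocycles₁_apply_conj_mem_subOneRange`) and passes from `x_i` to `⟨x_i⟩`
  (`localTubeSpan_cocycles₁_apply_mem_subOneRange_of_mem_closure_singleton`), while
  `φ(x₀) = φ(x₁) = 0` and `φ(x₂) = (1, 1) = T₂(y) - y` for `y = (0, 1/4)`;
* not a coboundary: `ρ(g) x - x = φ(g)` at `g = x₀, x₁` forces `x₁ = 0`, `x₀ = 0`, contradicting
  the value `(1, 1)` at `x₂`.

Hence `evalCoinv` kills the non-zero class `[φ]`:
`localTubeSpan_not_injective_evalCoinv_thin` (the registered stub).  So Schnell's Prop. 12 —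
and the crux's cyclic detection at a local fundamental group — is a property of vanishing
lattices, not of the Picard–Lefschetz formula.

References: [Schnell2010] C. Schnell, Primitive cohomology and the tube mapping, Math. Z. 268
(2010), §3 (the third map), §7 (Prop. 12 and the Example of a non-injective restriction map).
-/

-- `Summit.HodgeConjecture.HodgeConjecture.Theorems` is the mandated namespace (single-conjunct
-- summit: Sub = Summit), which `linter.dupNamespace` flags on every declaration; the lakefile turns
-- the linter off tree-wide (weak option), restated here so stand-alone elaboration is warning-free.
set_option linter.dupNamespace false

noncomputable section

open CategoryTheory groupCohomology
open Literature.AlgebraicGeometry.HodgeTheory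

namespace Summit.HodgeConjecture.HodgeConjecture.Theorems

universe u

/-! ### Undetectedness passes to cyclic subgroups -/

section General

variable {k G : Type u} [CommRing k] [Group G] (A : Rep k G)

/-- **Undetected at `t` ⇒ undetected on `⟨t⟩`.** If `φ t ∈ (t - 1)A`, say `φ t = t·y - y`, then
`φ` agrees with the coboundary `g ↦ g·y - y` at `t`, hence (zero sets of cocycles are subgroups)
on the whole cyclic subgroup `⟨t⟩`; in particular `φ (t ^ n) ∈ (t ^ n - 1)A` for every `n : ℤ`
(this is `H¹(⟨t⟩, A) ≅ A/(t - 1)A`). [folklore] -/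
theorem localTubeSpan_cocycles₁_apply_mem_subOneRange_of_mem_closure_singleton
    (φ : cocycles₁ A) (t : G) (ht : (φ : G → A.V) t ∈ subOneRange A t) {g : G}
    (hg : g ∈ Subgroup.closure ({t} : Set G)) : (φ : G → A.V) g ∈ subOneRange A g := by
  obtain ⟨y, hy⟩ := LinearMap.mem_range.1 ht
  -- the coboundary `g ↦ g·y - y` as a cocycle
  obtain ⟨ψ, hψ⟩ : ∃ ψ : cocycles₁ A, ∀ g', (ψ : G → A.V) g' = A.ρ g' y - y :=
    ⟨⟨fun g' => A.ρ g' y - y, (mem_cocycles₁_iff _).2 fun g₁ g₂ => by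
        rw [map_mul, Module.End.mul_apply, map_sub]; abel⟩, fun _ => rfl⟩
  -- `φ - ψ` vanishes at `t`, hence on `⟨t⟩`
  have h0 : ((φ - ψ : cocycles₁ A) : G → A.V) g = 0 := by
    refine localTubeSpan_cocycles₁_apply_eq_zero_of_mem_closure A _ {t} (fun g' hg' => ?_) hg
    rw [Set.mem_singleton_iff] at hg'
    change (φ : G → A.V) g' - (ψ : G → A.V) g' = 0
    rw [hψ, hg', ← hy, LinearMap.sub_apply, LinearMap.id_apply, sub_self]
  change (φ : G → A.V) g - (ψ : G → A.V) g = 0 at h0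
  rw [hψ, sub_eq_zero] at h0
  rw [h0]
  exact ⟨y, rfl⟩

end General

/-! ### `1`-cocycles of a free group are free on the generators -/

section Free

variable {k ι V : Type u} [CommRing k] [AddCommGroup V] [Module k V]

/-- **Cocycles on a free group.** For a representation `ρ` of the free group `F(ι)` on `V` and ANY
prescribed values `c : ι → V` there is a `1`-cocycle `φ ∈ Z¹(F(ι), V)` with `φ (x_i) = c_i` on the
free generators: a `1`-cocycle is the translation part `g ↦ σ(g)(0)` of a homomorphism
`σ : F(ι) → Aff(V)` lifting `ρ`, and `σ` is obtained from the universal property of the free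
group applied to the affine automorphisms `v ↦ ρ(x_i) v + c_i`. [folklore] -/
theorem localTubeSpan_freeGroup_exists_cocycles₁ (ρ : Representation k (FreeGroup ι) V)
    (c : ι → V) : ∃ φ : cocycles₁ (Rep.of ρ), ∀ i, φ (FreeGroup.of i) = c i := by
  -- each `ρ g` as a linear automorphism of `V`
  have hL : ∀ g : FreeGroup ι, ∃ L : V ≃ₗ[k] V, ∀ v, L v = ρ g v := fun g =>
    ⟨LinearEquiv.ofLinear (ρ g) (ρ g⁻¹) (LinearMap.ext fun v => ρ.self_inv_apply g v)
        (LinearMap.ext fun v => ρ.inv_self_apply g v), fun v => rfl⟩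
  choose L hL using hL
  -- the homomorphism `σ : F(ι) → Aff(V)` with `σ (x_i) = (v ↦ ρ(x_i) v + c_i)`
  obtain ⟨σ, hσ⟩ : ∃ σ : FreeGroup ι →* (V ≃ᵃ[k] V), ∀ i, σ (FreeGroup.of i) =
      (L (FreeGroup.of i)).toAffineEquiv.trans (AffineEquiv.constVAdd k V (c i)) :=
    ⟨FreeGroup.lift fun i =>
        (L (FreeGroup.of i)).toAffineEquiv.trans (AffineEquiv.constVAdd k V (c i)),
      fun i => FreeGroup.lift_apply_of⟩
  -- its linear part is `ρ` (two homomorphisms out of a free group agreeing on generators)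
  have hlin : ∀ (g : FreeGroup ι) (v : V), (σ g).linear v = ρ g v := by
    have key : LinearEquiv.automorphismGroup.toLinearMapMonoidHom.comp
        (AffineEquiv.linearHom.comp σ) = ρ := by
      refine FreeGroup.ext_hom _ _ fun i => LinearMap.ext fun v => ?_
      rw [MonoidHom.comp_apply, MonoidHom.comp_apply, hσ]
      exact hL (FreeGroup.of i) v
    intro g v
    simpa using LinearMap.congr_fun (DFunLike.congr_fun key g) v
  refine ⟨⟨fun g => σ g 0, (mem_cocycles₁_iff _).2 fun g h => ?_⟩, fun i => ?_⟩
  · -- the cocycle identity: `σ(gh)(0) = σ(g)(σ(h)(0)) = ρ(g)(σ(h)(0)) + σ(g)(0)`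
    show σ (g * h) 0 = ρ g (σ h 0) + σ g 0
    have e1 := (σ g).map_vadd 0 (σ h 0)
    rw [vadd_eq_add, vadd_eq_add, add_zero, hlin] at e1
    rw [map_mul, AffineEquiv.coe_mul, Function.comp_apply, e1]
  · -- the generator values: `σ(x_i)(0) = ρ(x_i) 0 + c_i = c_i`
    show σ (FreeGroup.of i) 0 = c i
    rw [hσ, AffineEquiv.trans_apply, LinearEquiv.coe_toAffineEquiv, map_zero,
      AffineEquiv.constVAdd_apply, vadd_eq_add, add_zero]

end Free

/-! ### The thin configuration: an undetected non-zero class -/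

/-- **The thin configuration defeats cyclic detection** (registered stub `stub_thinCocycle`).
Let `F₃ = ⟨x₀, x₁, x₂⟩` act on `ℚ²` through the integral symplectic transvections
`T₀(v) = (v₀ + 4v₁, v₁)`, `T₁(v) = (v₀, v₁ - 4v₀)`, `T₂(v) = v - 4(v₀ - v₁)(1, 1)` (the
Picard–Lefschetz transvections of `B₀(x, y) = 4(x₀y₁ - x₁y₀)` along `(1,0), (0,1), (1,1)`), and
assume the dichotomy `hclass`: for every `g`, either `ρ(g) - 1` is invertible or `g` is conjugate
to a power of a generator.  Then Schnell's third map `H¹(F₃, ℚ²) → ∏_g ℚ²/(g - 1)ℚ²` is NOT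
injective: the cocycle with `φ(x₀) = φ(x₁) = 0`, `φ(x₂) = (1, 1)` is undetected by every
element (`(1, 1) = T₂(y) - y` for `y = (0, 1/4)`; invertible `ρ(g) - 1` detect nothing;
conjugates and powers by `localTubeSpan_cocycles₁_apply_conj_mem_subOneRange` and
`localTubeSpan_cocycles₁_apply_mem_subOneRange_of_mem_closure_singleton`) but is not a
coboundary (`ρ(g)x - x = φ(g)` at `x₀, x₁` forces `x = 0`).  Contrast [Schnell2010] §7 Prop. 12,
where the transvections come from a vanishing lattice and the third map is injective. [folklore] -/
theorem localTubeSpan_not_injective_evalCoinv_thin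
    (ρ : Representation ℚ (FreeGroup (Fin 3)) (Fin 2 → ℚ))
    (hτ₀ : ∀ v, ρ (FreeGroup.of 0) v = ![v 0 + 4 * v 1, v 1])
    (hτ₁ : ∀ v, ρ (FreeGroup.of 1) v = ![v 0, v 1 - 4 * v 0])
    (hτ₂ : ∀ v, ρ (FreeGroup.of 2) v = ![v 0 - 4 * (v 0 - v 1), v 1 - 4 * (v 0 - v 1)])
    (hclass : ∀ g : FreeGroup (Fin 3), IsUnit (ρ g - 1) ∨
      ∃ (h : FreeGroup (Fin 3)) (i : Fin 3) (n : ℤ), g = h * FreeGroup.of i ^ n * h⁻¹) :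
    ¬ Function.Injective (evalCoinv (Rep.of ρ)) := by
  -- the cocycle `φ(x₀) = 0, φ(x₁) = 0, φ(x₂) = (1, 1)`
  obtain ⟨φ, hφ⟩ := localTubeSpan_freeGroup_exists_cocycles₁ ρ ![0, 0, ![1, 1]]
  have h0 : φ (FreeGroup.of 0) = (0 : Fin 2 → ℚ) := hφ 0
  have h1 : φ (FreeGroup.of 1) = (0 : Fin 2 → ℚ) := hφ 1
  have h2 : φ (FreeGroup.of 2) = ![1, 1] := hφ 2
  refine localTubeSpan_not_injective_evalCoinv_of_undetected (Rep.of ρ) φ φ.2 ?_ fun g => ?_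
  · -- `[φ] ≠ 0`: `ρ g x - x = φ g` at `x₀, x₁` forces `x = 0`, contradicting the value at `x₂`
    rw [mem_coboundaries₁_iff_exists]
    rintro ⟨x, hx⟩
    have e0 := congr_fun (hx (FreeGroup.of 0)) 0
    have e1 := congr_fun (hx (FreeGroup.of 1)) 1
    have e2 := congr_fun (hx (FreeGroup.of 2)) 0
    rw [h0] at e0
    rw [h1] at e1
    rw [h2] at e2
    simp [hτ₀, hτ₁, hτ₂] at e0 e1 e2
    linarith
  · -- `φ` is undetected by every `g`, via the dichotomy `hclass`
    rcases hclass g with hu | ⟨h, i, n, rfl⟩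
    · -- `ρ g - 1` invertible: `(g - 1)A = A`
      obtain ⟨y, hy⟩ := ((Module.End.isUnit_iff _).1 hu).2 (φ g)
      exact ⟨y, hy⟩
    · -- `g = h x_i ^ n h⁻¹`: reduce to `x_i ^ n` (conjugation), then to `x_i` (cyclic subgroup)
      refine localTubeSpan_cocycles₁_apply_conj_mem_subOneRange (Rep.of ρ) φ
        (FreeGroup.of i ^ n) h ?_
      refine localTubeSpan_cocycles₁_apply_mem_subOneRange_of_mem_closure_singleton (Rep.of ρ)
        φ (FreeGroup.of i) ?_ (Subgroup.mem_closure_singleton.2 ⟨n, rfl⟩)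
      fin_cases i
      · show φ (FreeGroup.of 0) ∈ subOneRange (Rep.of ρ) (FreeGroup.of 0)
        rw [h0]
        exact Submodule.zero_mem _
      · show φ (FreeGroup.of 1) ∈ subOneRange (Rep.of ρ) (FreeGroup.of 1)
        rw [h1]
        exact Submodule.zero_mem _
      · -- `T₂` moves `y = (0, 1/4)` by `-4 (y₀ - y₁) (1, 1) = (1, 1)`
        show φ (FreeGroup.of 2) ∈ subOneRange (Rep.of ρ) (FreeGroup.of 2)
        rw [h2]
        refine ⟨![0, 1 / 4], ?_⟩
        rw [LinearMap.sub_apply, LinearMap.id_apply, Rep.of_ρ, hτ₂]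
        funext j
        fin_cases j <;> simp

end Summit.HodgeConjecture.HodgeConjecture.Theorems

end
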